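import Summits.BirchSwinnertonDyer.BirchSwinnertonDyer.Theorems.ManinLocalTwoThreeMultiShiftSpanColumns
import HarnessLib

/-!
# Route `ManinLocalTwoThree`, crux C3 `ManinPrimeToThreeAtNine` (stmt-BirchSwinnertonDyer-22968), line `kato-shift-three`
# (es g6): the span of the SHIFT CLASSES `{a/ℓ, 3a/ℓ}_f` over Legendre-admissible primes `ℓ ≥ ℓ₀` is PRIME-FREE and
# `ℓ₀`-FREE — it is the span of the column differences `{∞, 3b/d}_f − {∞, b/d}_f` over the coprime pairs `(b, d)`,
# `gcd(d, Nb) = 1`, with `d` in the admissible residue classes (line prover p3; helper, unconditional; the `p = 3`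
# twin of `…MultiShiftSpanColumns`)

In E-es-19 `ShiftClassGenerationThree` (leaf `KatoShiftThreeLaws`, stub `stub_shiftClass_generation`) the shift
classes `{0, 3a/ℓ}_f − {0, a/ℓ}_f` are indexed by the admissible primes `ℓ ≥ ℓ₀`: `ℓ ∤ N`, `ℓ ≡ 11 (mod 12)`,
`(q/ℓ) = ε_q` at every `q ∥ N` (`ε = epsSign W`).  For `9 ∣ N`, any signs `ε_q = ±1` and EVERY `ℓ₀` we prove that the
subgroup of `ℂ` they generate is the subgroup generated by the differences `{∞, 3b/d}_f − {∞, b/d}_f` over all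
`b d : ℤ` with `d ≠ 0`, `gcd(d, Nb) = 1`, `d ≡ 2 (mod 3)`, `d ≡ 3 (mod 4)` if `4 ∣ N`, and `(d/q) = ±ε_q` (sign by
`q mod 4`, quadratic reciprocity) at the odd `q ∥ N` — no primes, no `ℓ₀`, and NO condition at `2` when `4 ∤ N`:
* `shiftPair_mem_closure_admissible` — such a difference is a shift class at an admissible prime `ℓ > n₀` (moves
  `b ↦ b + jd`, `d ↦ d + 3Nkb` preserving both symbols; `b` odd, `d mod 8` steered when `4 ∤ N`, `8 ∣ b`; one
  Dirichlet prime `ℓ ≡ d (mod 3N|b|)`; Jacobi symbols by reciprocity);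
* `shiftSpan_admissible_eq_closure_columns` — the equality of spans; `shiftSpan_admissible_eq_of_le` — independence
  of `ℓ₀` (the cofinal `∀ ℓ₀` form of E-es-19 coincides with its `ℓ₀ = 0` instance).
Nothing about BSD, Manin's conjecture or E-es-19 itself is proved here.
-/

set_option autoImplicit false
set_option linter.dupNamespace false

noncomputable section

open scoped Classical MatrixGroups ModularForm BigOperators

open CongruenceSubgroup Matrix.SpecialLinearGroup ModularGroup
  Literature.NumberTheory.EllipticCurves Literature.NumberTheory.EllipticCurves.ModularForms

namespace Summit.BirchSwinnertonDyer.BirchSwinnertonDyer.Theorems.ManinLocalTwoThree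

section ShiftColumns

variable {N : ℕ} [NeZero N] (f : CuspForm (Gamma0 N) 2)

/-- **Translation move**: `{∞, (β + jd)/d}_f = {∞, β/d}_f` (`{∞, r + j} = {∞, r}`). [cite: Manin1972, §1.2] -/
theorem modularSymbol_div_add_mul_eq (β d j : ℤ) (hd : d ≠ 0) :
    modularSymbol f (((β + j * d : ℤ) : ℚ) / d) = modularSymbol f ((β : ℚ) / d) := by
  have hdQ : (d : ℚ) ≠ 0 := by exact_mod_cast hd
  have : (((β + j * d : ℤ) : ℚ) / d) = (β : ℚ) / d + ((j : ℤ) : ℚ) := by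
    push_cast
    field_simp
  rw [this, modularSymbol_add_intCast_holds f]

/-- **Normal form of an admissible column.** Under the hypotheses of `shiftPair_mem_closure_admissible`, and
given the target residue `r ∈ {3, 7}` mod `8`, the moves `b ↦ b + jd` and `d ↦ d + 3Nkb` (which preserve both symbols
`{∞, b/d}_f`, `{∞, 3b/d}_f`) lead to a pair `(b₃, d₂)` with `8 ∣ b₃ ≠ 0`, `gcd(d₂, b₃) = 1`, `d₂ ≡ d (mod N)`,
`d₂ ≡ 3 (mod 4)`, and `d₂ ≡ r (mod 8)` when `4 ∤ N`. [folklore] -/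
theorem exists_shiftPair_normalForm (b d : ℤ) (hd0 : d ≠ 0) (hcop : IsCoprime d (N * b))
    (hd4 : 4 ∣ N → d % 4 = 3) (r : ℤ) (hr : r = 7 ∨ r = 3) :
    ∃ b₃ d₂ : ℤ, d₂ ≠ 0 ∧ b₃ ≠ 0 ∧ (8 : ℤ) ∣ b₃ ∧ IsCoprime d₂ b₃ ∧ d₂ ≡ d [ZMOD N] ∧ d₂ % 4 = 3 ∧
      (¬ 4 ∣ N → d₂ % 8 = r) ∧
      modularSymbol f (((3 * b : ℤ) : ℚ) / d) - modularSymbol f ((b : ℚ) / d) =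
        modularSymbol f (((3 * b₃ : ℤ) : ℚ) / d₂) - modularSymbol f ((b₃ : ℚ) / d₂) := by
  have two_not_unit : ¬ IsUnit (2 : ℤ) := by
    intro h; rcases Int.isUnit_iff.mp h with h | h <;> norm_num at h
  have hcopN : IsCoprime d (N : ℤ) := hcop.of_mul_right_left
  have hcopb : IsCoprime d b := hcop.of_mul_right_right
  -- Step A: make `b` odd
  obtain ⟨b₁, hb₁odd, hb₁cop, hE₁⟩ : ∃ b₁ : ℤ, b₁ % 2 = 1 ∧ IsCoprime d b₁ ∧
      modularSymbol f (((3 * b : ℤ) : ℚ) / d) - modularSymbol f ((b : ℚ) / d) =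
        modularSymbol f (((3 * b₁ : ℤ) : ℚ) / d) - modularSymbol f ((b₁ : ℚ) / d) := by
    by_cases hbodd : b % 2 = 1
    · exact ⟨b, hbodd, hcopb, rfl⟩
    · have hdodd : d % 2 = 1 := by
        by_contra hd2
        have h2b : (2 : ℤ) ∣ b := by omega
        have h2d : (2 : ℤ) ∣ d := by omega
        exact two_not_unit (hcopb.isUnit_of_dvd' h2d h2b)
      refine ⟨b + 1 * d, by omega, hcopb.add_mul_right_right 1, ?_⟩
      rw [show (3 * (b + 1 * d) : ℤ) = 3 * b + 3 * d by ring, modularSymbol_div_add_mul_eq f (3 * b) d 3 hd0,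
        modularSymbol_div_add_mul_eq f b d 1 hd0]
  -- Step B: steer `d mod 8` when `4 ∤ N` by `d ↦ d + 3 N k b₁`
  obtain ⟨d₂, hd₂N, hd₂4, hd₂8, hd₂cop, hd₂0, hE₂⟩ : ∃ d₂ : ℤ, d₂ ≡ d [ZMOD N] ∧ d₂ % 4 = 3 ∧
      (¬ 4 ∣ N → d₂ % 8 = r) ∧ IsCoprime d₂ b₁ ∧ d₂ ≠ 0 ∧
      modularSymbol f (((3 * b₁ : ℤ) : ℚ) / d) - modularSymbol f ((b₁ : ℚ) / d) =
        modularSymbol f (((3 * b₁ : ℤ) : ℚ) / d₂) - modularSymbol f ((b₁ : ℚ) / d₂) := by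
    by_cases h4 : 4 ∣ N
    · exact ⟨d, Int.ModEq.refl d, hd4 h4, fun h => absurd h4 h, hb₁cop, hd0, rfl⟩
    · obtain ⟨k, hk⟩ : ∃ k : ℤ, (d + 3 * N * k * b₁) % 8 = r := by
        have hr8 : r % 8 = r := by rcases hr with rfl | rfl <;> norm_num
        by_cases h2 : 2 ∣ N
        · obtain ⟨N', hN'⟩ := h2
          have hN'odd : (N' : ℤ) % 2 = 1 := by
            have : ¬ 2 ∣ N' := fun ⟨m, hm⟩ => h4 ⟨m, by rw [hN', hm]; ring⟩
            have : N' % 2 = 1 := Nat.two_dvd_ne_zero.mp this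
            exact_mod_cast congrArg (Nat.cast : ℕ → ℤ) this
          have hdodd : d % 2 = 1 := by
            by_contra hd2
            have h2d : (2 : ℤ) ∣ d := by omega
            have h2N : (2 : ℤ) ∣ (N : ℤ) := ⟨N', by rw [hN']; push_cast; ring⟩
            exact two_not_unit (hcopN.isUnit_of_dvd' h2d h2N)
          set g : ℤ := 3 * N' * b₁ with hg
          have hgodd : g % 2 = 1 := by
            rw [hg, Int.mul_emod, Int.mul_emod 3, hN'odd, hb₁odd]
            norm_num
          obtain ⟨t, ht⟩ := exists_sq_eq_eight_mul_add_one hgodd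
          obtain ⟨m, hm⟩ : ∃ m : ℤ, r - d = 2 * m := ⟨(r - d) / 2, by omega⟩
          refine ⟨g * m, ?_⟩
          have : d + 3 * (N : ℤ) * (g * m) * b₁ = r + 8 * (2 * m * t) := by
            rw [hN']
            push_cast
            linear_combination (2 * m) * ht - hm
          rw [this, Int.add_mul_emod_self_left, hr8]
        · have hNodd : (N : ℤ) % 2 = 1 := by
            have : N % 2 = 1 := Nat.two_dvd_ne_zero.mp h2
            exact_mod_cast congrArg (Nat.cast : ℕ → ℤ) this
          set g : ℤ := 3 * N * b₁ with hg
          have hgodd : g % 2 = 1 := by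
            rw [hg, Int.mul_emod, Int.mul_emod 3, hNodd, hb₁odd]
            norm_num
          obtain ⟨t, ht⟩ := exists_sq_eq_eight_mul_add_one hgodd
          refine ⟨g * (r - d), ?_⟩
          have : d + 3 * (N : ℤ) * (g * (r - d)) * b₁ = r + 8 * (t * (r - d)) := by
            linear_combination (r - d) * ht
          rw [this, Int.add_mul_emod_self_left, hr8]
      have hd₂0 : d + 3 * N * k * b₁ ≠ 0 := by
        intro h0; rw [h0] at hk; rcases hr with h | h <;> rw [h] at hk <;> norm_num at hk
      refine ⟨d + 3 * N * k * b₁, Int.modEq_iff_dvd.mpr ⟨-(3 * k * b₁), by ring⟩, by omega, fun _ => hk,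
        hb₁cop.add_mul_right_left (3 * N * k), hd₂0, ?_⟩
      rw [show (d + 3 * (N : ℤ) * k * b₁ : ℤ) = d + N * k * (3 * b₁) by ring,
        ← modularSymbol_div_eq_div_add_mul f (3 * b₁) d k hd0 (by
          rw [show (d + (N : ℤ) * k * (3 * b₁) : ℤ) = d + 3 * N * k * b₁ by ring]; exact hd₂0),
        show (d + (N : ℤ) * k * (3 * b₁) : ℤ) = d + N * (3 * k) * b₁ by ring,
        ← modularSymbol_div_eq_div_add_mul f b₁ d (3 * k) hd0 (by
          rw [show (d + (N : ℤ) * (3 * k) * b₁ : ℤ) = d + 3 * N * k * b₁ by ring]; exact hd₂0)]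
  have hd₂odd : d₂ % 2 = 1 := by omega
  -- Step C: make `8 ∣ b` by `b ↦ b + (8 − b d₂) d₂`
  set b₃ : ℤ := b₁ + (8 - b₁ * d₂) * d₂ with hb₃
  obtain ⟨t, ht⟩ := exists_sq_eq_eight_mul_add_one hd₂odd
  have h8 : (8 : ℤ) ∣ b₃ := ⟨d₂ - b₁ * t, by rw [hb₃]; linear_combination (-b₁) * ht⟩
  have hb₃cop : IsCoprime d₂ b₃ := by
    rw [hb₃]
    exact hd₂cop.add_mul_right_right (8 - b₁ * d₂)
  have hb₃0 : b₃ ≠ 0 := by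
    intro h0
    have hu : IsUnit d₂ := by
      have := hb₃cop
      rw [h0, isCoprime_zero_right] at this
      exact this
    rcases Int.isUnit_iff.mp hu with h1 | h1
    · rw [hb₃, h1] at h0
      omega
    · rw [hb₃, h1] at h0
      omega
  have hE₃ : modularSymbol f (((3 * b₁ : ℤ) : ℚ) / d₂) - modularSymbol f ((b₁ : ℚ) / d₂) =
      modularSymbol f (((3 * b₃ : ℤ) : ℚ) / d₂) - modularSymbol f ((b₃ : ℚ) / d₂) := by
    rw [hb₃, show (3 * (b₁ + (8 - b₁ * d₂) * d₂) : ℤ) = 3 * b₁ + (3 * (8 - b₁ * d₂)) * d₂ by ring,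
      modularSymbol_div_add_mul_eq f (3 * b₁) d₂ _ hd₂0, modularSymbol_div_add_mul_eq f b₁ d₂ _ hd₂0]
  exact ⟨b₃, d₂, hd₂0, hb₃0, h8, hb₃cop.symm.symm, hd₂N, hd₂4, hd₂8, by rw [hE₁, hE₂, hE₃]⟩

/-- **A column difference with admissible `d` is a shift class at an admissible prime.** Let `9 ∣ N`, `ε_q = ±1`,
and let `b, d` be integers with `d ≠ 0`, `gcd(d, Nb) = 1`, `d ≡ 2 (mod 3)`, `d ≡ 3 (mod 4)` if `4 ∣ N`, and
`(d/q) = ε_q` resp. `−ε_q` at the odd `q ∥ N` with `q ≡ 1` resp. `3 (mod 4)`. Then for every `n₀` the difference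
`{∞, 3b/d}_f − {∞, b/d}_f` is a shift class `({∞, 3a/ℓ} − {∞, 0}) − ({∞, a/ℓ} − {∞, 0})` at a prime `ℓ > n₀`,
`ℓ ∤ N`, `ℓ ≡ 11 (mod 12)`, `(q/ℓ) = ε_q` for all `q ∥ N`, `0 < a < ℓ`. [folklore] -/
theorem shiftPair_mem_closure_admissible (ε : ℕ → ℤ) (hε : ∀ q, ε q = 1 ∨ ε q = -1) (h9 : 9 ∣ N)
    (b d : ℤ) (hd0 : d ≠ 0) (hcop : IsCoprime d (N * b)) (hd3 : d % 3 = 2) (hd4 : 4 ∣ N → d % 4 = 3)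
    (hdq : ∀ q ∈ N.primeFactors, q ≠ 2 → ¬ q ^ 2 ∣ N → jacobiSym d q = if q % 4 = 1 then ε q else -ε q)
    (n₀ : ℕ) :
    modularSymbol f (((3 * b : ℤ) : ℚ) / d) - modularSymbol f ((b : ℚ) / d) ∈ AddSubgroup.closure
      {z : ℂ | ∃ ℓ : ℕ, ℓ.Prime ∧ n₀ < ℓ ∧ ¬ ℓ ∣ N ∧ ℓ % 12 = 11 ∧
        (∀ q ∈ N.primeFactors, ¬ q ^ 2 ∣ N → jacobiSym (q : ℤ) ℓ = ε q) ∧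
        ∃ a : ℕ, 0 < a ∧ a < ℓ ∧ z = (modularSymbol f (((3 * a : ℕ) : ℚ) / ℓ) - modularSymbol f 0) -
          (modularSymbol f ((a : ℚ) / ℓ) - modularSymbol f 0)} := by
  have hN0 : 0 < N := Nat.pos_of_ne_zero (NeZero.ne N)
  have h3 : 3 ∣ N := dvd_trans (by norm_num) h9
  have two_not_unit : ¬ IsUnit (2 : ℤ) := by
    intro h; rcases Int.isUnit_iff.mp h with h | h <;> norm_num at h
  have hcopN : IsCoprime d (N : ℤ) := hcop.of_mul_right_left
  have hcopb : IsCoprime d b := hcop.of_mul_right_right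
  -- the target residue mod 8 (used when `4 ∤ N`)
  obtain ⟨r, hr, hrε⟩ : ∃ r : ℤ, (r = 7 ∨ r = 3) ∧ (r = 7 ↔ ε 2 = 1) := by
    rcases hε 2 with h | h
    · exact ⟨7, Or.inl rfl, by simp [h]⟩
    · exact ⟨3, Or.inr rfl, by constructor <;> intro h' <;> simp_all⟩
  obtain ⟨b₃, d₂, hd₂0, hb₃0, h8, hb₃cop, hd₂N, hd₂4, hd₂8, hE⟩ :=
    exists_shiftPair_normalForm f b d hd0 hcop hd4 r hr
  have hd₂odd : d₂ % 2 = 1 := by omega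
  -- Step D: a Dirichlet prime `ℓ ≡ d₂ (mod 3 N |b₃|)`
  set Q : ℕ := 3 * N * b₃.natAbs with hQ
  have hQ0 : Q ≠ 0 := mul_ne_zero (mul_ne_zero (by norm_num) (NeZero.ne N)) (Int.natAbs_ne_zero.mpr hb₃0)
  have hQabs : (Q : ℤ) = 3 * N * |b₃| := by rw [hQ]; push_cast; ring
  have hd₂copN : IsCoprime d₂ (N : ℤ) := by
    obtain ⟨c, hc⟩ := Int.modEq_iff_dvd.mp hd₂N
    -- hc : d - d₂ = N * c, so d₂ = d + N * (-c)
    have : d₂ = d + (N : ℤ) * (-c) := by linear_combination -hc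
    rw [this]
    exact (hcopN.symm.add_mul_left_right (-c)).symm
  have hd₂cop3 : IsCoprime d₂ (3 : ℤ) :=
    hd₂copN.of_isCoprime_of_dvd_right (by exact_mod_cast h3)
  have hcopQ : IsCoprime d₂ (Q : ℤ) := by
    rw [hQabs]
    refine (hd₂cop3.mul_right hd₂copN).mul_right ?_
    rcases abs_choice b₃ with h | h
    · rw [h]; exact hb₃cop
    · rw [h]; exact hb₃cop.neg_right
  obtain ⟨ℓ, hℓn, hℓp, hℓd⟩ := Nat.forall_exists_prime_gt_and_zmodEq (n₀ + N) hQ0 hcopQ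
  obtain ⟨m, hm⟩ := Int.modEq_iff_dvd.mp hℓd
  haveI : NeZero ℓ := ⟨hℓp.ne_zero⟩
  have hℓ0 : (ℓ : ℤ) ≠ 0 := by exact_mod_cast hℓp.ne_zero
  obtain ⟨s, hs⟩ : ∃ s : ℤ, |b₃| = s * b₃ := by
    rcases abs_choice b₃ with h | h
    · exact ⟨1, by rw [h]; ring⟩
    · exact ⟨-1, by rw [h]; ring⟩
  have hℓ1 : (ℓ : ℤ) = d₂ + N * (-(3 * m * s)) * b₃ := by
    have : (ℓ : ℤ) = d₂ - Q * m := by linear_combination -hm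
    rw [this, hQabs, hs]; ring
  have hℓ3 : (ℓ : ℤ) = d₂ + N * (-(m * s)) * (3 * b₃) := by rw [hℓ1]; ring
  -- the two symbols at `d₂` are the symbols at `ℓ`
  set a : ℕ := (b₃ : ZMod ℓ).val with ha
  have hbmod : ((a : ℕ) : ℤ) = b₃ % ℓ := by rw [ha]; exact ZMod.val_intCast b₃
  have haZ : ((a : ℕ) : ℤ) = b₃ + (-(b₃ / ℓ)) * ℓ := by rw [hbmod, Int.emod_def]; ring
  have hsym1 : modularSymbol f ((b₃ : ℚ) / d₂) = modularSymbol f ((a : ℚ) / ℓ) := by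
    rw [modularSymbol_div_eq_div_add_mul f b₃ d₂ _ hd₂0 (by rw [← hℓ1]; exact hℓ0), ← hℓ1]
    have : ((a : ℕ) : ℚ) / ℓ = (((b₃ + (-(b₃ / ℓ)) * ℓ : ℤ) : ℚ)) / ((ℓ : ℤ) : ℚ) := by
      rw [← haZ]; push_cast; rfl
    rw [this, modularSymbol_div_add_mul_eq f b₃ ℓ _ hℓ0]
  have hsym3 : modularSymbol f (((3 * b₃ : ℤ) : ℚ) / d₂) = modularSymbol f (((3 * a : ℕ) : ℚ) / ℓ) := by
    rw [modularSymbol_div_eq_div_add_mul f (3 * b₃) d₂ _ hd₂0 (by rw [← hℓ3]; exact hℓ0), ← hℓ3]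
    have : (((3 * a : ℕ)) : ℚ) / ℓ = (((3 * b₃ + (-(3 * (b₃ / ℓ))) * ℓ : ℤ) : ℚ)) / ((ℓ : ℤ) : ℚ) := by
      have : ((3 * a : ℕ) : ℤ) = 3 * b₃ + (-(3 * (b₃ / ℓ))) * ℓ := by push_cast; rw [haZ]; ring
      rw [show (((3 * a : ℕ)) : ℚ) = (((3 * a : ℕ) : ℤ) : ℚ) by push_cast; rfl, this]
      push_cast
      rfl
    rw [this, modularSymbol_div_add_mul_eq f (3 * b₃) ℓ _ hℓ0]
  -- `0 < a`
  have ha0 : 0 < a := by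
    rw [Nat.pos_iff_ne_zero, ha, ne_eq, ZMod.val_eq_zero]
    intro h0
    have hdvd : (ℓ : ℤ) ∣ b₃ := (ZMod.intCast_zmod_eq_zero_iff_dvd b₃ ℓ).mp h0
    have hcopℓ : IsCoprime (ℓ : ℤ) b₃ := by
      rw [hℓ1]
      exact hb₃cop.add_mul_right_left _
    have hu : IsUnit (ℓ : ℤ) := hcopℓ.isUnit_of_dvd' (dvd_refl _) hdvd
    rcases Int.isUnit_iff.mp hu with h1 | h1
    · exact hℓp.one_lt.ne' (by exact_mod_cast h1)
    · have : (0 : ℤ) ≤ (ℓ : ℤ) := by positivity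
      omega
  -- admissibility of `ℓ`
  have hℓN : (ℓ : ℤ) ≡ d [ZMOD N] :=
    (Int.modEq_iff_dvd.mpr ⟨3 * m * s * b₃, by rw [hℓ1]; ring⟩ : (ℓ : ℤ) ≡ d₂ [ZMOD N]).trans hd₂N
  have hℓ8 : (ℓ : ℤ) % 8 = d₂ % 8 := by
    obtain ⟨b', hb'⟩ := h8
    have : (ℓ : ℤ) = d₂ + 8 * (N * (-(3 * m * s)) * b') := by rw [hℓ1, hb']; ring
    rw [this, Int.add_mul_emod_self_left]
  have hℓ4 : ℓ % 4 = 3 := by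
    have : (ℓ : ℤ) % 4 = 3 := by omega
    omega
  have hℓ3' : ℓ % 3 = 2 := by
    have h := hℓN.of_dvd (by exact_mod_cast h3 : (3 : ℤ) ∣ (N : ℤ))
    have : (ℓ : ℤ) % 3 = d % 3 := h
    omega
  have hℓ12 : ℓ % 12 = 11 := by omega
  have hℓgt : N < ℓ := lt_of_le_of_lt (Nat.le_add_left _ _) hℓn
  have hℓNdvd : ¬ ℓ ∣ N := fun h => absurd (Nat.le_of_dvd hN0 h) (not_le.mpr hℓgt)
  have hℓodd : Odd ℓ := Nat.odd_iff.mpr (by rw [← Nat.mod_mod_of_dvd ℓ (by norm_num : 2 ∣ 4), hℓ4])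
  have hJ : ∀ q ∈ N.primeFactors, ¬ q ^ 2 ∣ N → jacobiSym (q : ℤ) ℓ = ε q := by
    intro q hq hq2N
    have hqp : q.Prime := Nat.prime_of_mem_primeFactors hq
    have hqN : q ∣ N := Nat.dvd_of_mem_primeFactors hq
    by_cases hq2 : q = 2
    · subst hq2
      have h4 : ¬ 4 ∣ N := fun h => hq2N (by norm_num; exact h)
      have hd₂r : d₂ % 8 = r := hd₂8 h4
      have hℓ8' : (ℓ : ℤ) % 8 = r := by rw [hℓ8, hd₂r]
      have hℓ2 : ℓ % 2 ≠ 0 := by rw [Nat.odd_iff.mp hℓodd]; exact one_ne_zero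
      rw [Nat.cast_ofNat, jacobiSym.at_two hℓodd, ZMod.χ₈_nat_eq_if_mod_eight, if_neg hℓ2]
      rcases hε 2 with h1 | h1
      · have hr7 : r = 7 := hrε.mpr h1
        have : ℓ % 8 = 7 := by
          have : ((ℓ % 8 : ℕ) : ℤ) = 7 := by push_cast; rw [hℓ8', hr7]
          exact_mod_cast this
        rw [if_pos (Or.inr this), h1]
      · have hr3 : r = 3 := by
          rcases hr with h | h
          · exact absurd (hrε.mp h) (by rw [h1]; norm_num)
          · exact h
        have : ℓ % 8 = 3 := by
          have : ((ℓ % 8 : ℕ) : ℤ) = 3 := by push_cast; rw [hℓ8', hr3]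
          exact_mod_cast this
        rw [this, if_neg (by norm_num), h1]
    · have hℓq : (ℓ : ℤ) % q = d % q := hℓN.of_dvd (Int.natCast_dvd_natCast.mpr hqN)
      have hJℓ : jacobiSym (ℓ : ℤ) q = jacobiSym d q := jacobiSym.mod_left' hℓq
      have hdq' := hdq q hq hq2 hq2N
      have hq4 : q % 4 = 1 ∨ q % 4 = 3 := by
        rcases hqp.eq_two_or_odd with h | h
        · exact absurd h hq2
        · omega
      rcases hq4 with hq1 | hq3
      · rw [jacobiSym.quadratic_reciprocity_one_mod_four hq1 hℓodd, hJℓ, hdq', if_pos hq1]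
      · rw [jacobiSym.quadratic_reciprocity_three_mod_four hq3 hℓ4, hJℓ, hdq', if_neg (by omega),
          neg_neg]
  -- conclude
  rw [hE, hsym1, hsym3]
  refine AddSubgroup.subset_closure ⟨ℓ, hℓp, by omega, hℓNdvd, hℓ12, hJ, a, ha0, ZMod.val_lt _, ?_⟩
  push_cast
  ring

/-- **The shift span is prime-free and `ℓ₀`-free.** For `9 ∣ N`, any signs `ε_q = ±1` and every `ℓ₀`, the subgroup
of `ℂ` generated by the shift classes `({∞, 3a/ℓ}_f − {∞, 0}_f) − ({∞, a/ℓ}_f − {∞, 0}_f)` over the admissible primes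
`ℓ ≥ ℓ₀` (`ℓ ∤ N`, `ℓ ≡ 11 (mod 12)`, `(q/ℓ) = ε_q` at every `q ∥ N`; E-es-19's index set at `ε = epsSign W`) and
`0 < a < ℓ` equals the subgroup generated by the column differences `{∞, 3b/d}_f − {∞, b/d}_f` over `b d : ℤ` with
`d ≠ 0`, `gcd(d, Nb) = 1`, `d ≡ 2 (mod 3)`, `d ≡ 3 (mod 4)` if `4 ∣ N`, and `(d/q) = ±ε_q` (sign by `q mod 4`) at the
odd `q ∥ N`. [folklore] -/
theorem shiftSpan_admissible_eq_closure_columns (ε : ℕ → ℤ) (hε : ∀ q, ε q = 1 ∨ ε q = -1) (h9 : 9 ∣ N)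
    (ℓ₀ : ℕ) :
    AddSubgroup.closure
      {z : ℂ | ∃ ℓ ∈ {ℓ : ℕ | ℓ₀ ≤ ℓ ∧ (ℓ.Prime ∧ ¬ ℓ ∣ N ∧ ℓ % 12 = 11 ∧
          ∀ q ∈ N.primeFactors, ¬ q ^ 2 ∣ N → jacobiSym (q : ℤ) ℓ = ε q)},
        ∃ a : ℕ, 0 < a ∧ a < ℓ ∧ z = (modularSymbol f (((3 * a : ℕ) : ℚ) / ℓ) - modularSymbol f 0) -
          (modularSymbol f ((a : ℚ) / ℓ) - modularSymbol f 0)} =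
    AddSubgroup.closure
      {z : ℂ | ∃ b d : ℤ, d ≠ 0 ∧ IsCoprime d (N * b) ∧ d % 3 = 2 ∧ (4 ∣ N → d % 4 = 3) ∧
          (∀ q ∈ N.primeFactors, q ≠ 2 → ¬ q ^ 2 ∣ N →
            jacobiSym d q = if q % 4 = 1 then ε q else -ε q) ∧
          z = modularSymbol f (((3 * b : ℤ) : ℚ) / d) - modularSymbol f ((b : ℚ) / d)} := by
  have hN0 : 0 < N := Nat.pos_of_ne_zero (NeZero.ne N)
  apply le_antisymm
  · -- `⊆`: an admissible shift class is a column difference with `d = ℓ`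
    rw [AddSubgroup.closure_le]
    rintro z ⟨ℓ, ⟨-, hℓp, hℓN, hℓ12, hℓJ⟩, a, ha0, ha, rfl⟩
    apply AddSubgroup.subset_closure
    have hℓodd : Odd ℓ := Nat.odd_iff.mpr (by omega)
    have hℓ4 : ℓ % 4 = 3 := by omega
    refine ⟨a, ℓ, by exact_mod_cast hℓp.ne_zero, ?_, by omega, fun _ => by omega, ?_, ?_⟩
    · have hℓa : ¬ ℓ ∣ a := fun h => absurd (Nat.le_of_dvd ha0 h) (not_le.mpr ha)
      refine IsCoprime.mul_right ?_ ?_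
      · rw [Int.isCoprime_iff_gcd_eq_one, Int.gcd_natCast_natCast]
        exact (Nat.Prime.coprime_iff_not_dvd hℓp).mpr hℓN
      · rw [Int.isCoprime_iff_gcd_eq_one, Int.gcd_natCast_natCast]
        exact (Nat.Prime.coprime_iff_not_dvd hℓp).mpr hℓa
    · intro q hq hq2 hq2N
      have hqp : q.Prime := Nat.prime_of_mem_primeFactors hq
      have hJ := hℓJ q hq hq2N
      have hq4 : q % 4 = 1 ∨ q % 4 = 3 := by
        rcases hqp.eq_two_or_odd with h | h
        · exact absurd h hq2
        · omega
      rcases hq4 with hq1 | hq3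
      · rw [← jacobiSym.quadratic_reciprocity_one_mod_four hq1 hℓodd, hJ, if_pos hq1]
      · rw [if_neg (by omega), ← hJ, jacobiSym.quadratic_reciprocity_three_mod_four hq3 hℓ4, neg_neg]
    · push_cast
      ring
  · -- `⊇`: `shiftPair_mem_closure_admissible`
    rw [AddSubgroup.closure_le]
    rintro z ⟨b, d, hd0, hcop, hd3, hd4, hdq, rfl⟩
    refine AddSubgroup.closure_mono ?_
      (shiftPair_mem_closure_admissible f ε hε h9 b d hd0 hcop hd3 hd4 hdq ℓ₀)
    rintro w ⟨ℓ, hℓp, hℓn, hℓN, hℓ12, hℓq, a, ha0, ha, rfl⟩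
    exact ⟨ℓ, ⟨hℓn.le, hℓp, hℓN, hℓ12, hℓq⟩, a, ha0, ha, rfl⟩

/-- **The shift span does not depend on `ℓ₀`**: for `9 ∣ N`, any signs `ε_q = ±1` and any `ℓ₀, ℓ₁`, the shift classes
over admissible primes `ℓ ≥ ℓ₀` and over admissible primes `ℓ ≥ ℓ₁` generate the same subgroup of `ℂ`; in particular
the cofinal `∀ ℓ₀` form of E-es-19 coincides with its `ℓ₀ = 0` instance. [folklore] -/
theorem shiftSpan_admissible_eq_of_le (ε : ℕ → ℤ) (hε : ∀ q, ε q = 1 ∨ ε q = -1) (h9 : 9 ∣ N) (ℓ₀ ℓ₁ : ℕ) :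
    AddSubgroup.closure
      {z : ℂ | ∃ ℓ ∈ {ℓ : ℕ | ℓ₀ ≤ ℓ ∧ (ℓ.Prime ∧ ¬ ℓ ∣ N ∧ ℓ % 12 = 11 ∧
          ∀ q ∈ N.primeFactors, ¬ q ^ 2 ∣ N → jacobiSym (q : ℤ) ℓ = ε q)},
        ∃ a : ℕ, 0 < a ∧ a < ℓ ∧ z = (modularSymbol f (((3 * a : ℕ) : ℚ) / ℓ) - modularSymbol f 0) -
          (modularSymbol f ((a : ℚ) / ℓ) - modularSymbol f 0)} =
    AddSubgroup.closure
      {z : ℂ | ∃ ℓ ∈ {ℓ : ℕ | ℓ₁ ≤ ℓ ∧ (ℓ.Prime ∧ ¬ ℓ ∣ N ∧ ℓ % 12 = 11 ∧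
          ∀ q ∈ N.primeFactors, ¬ q ^ 2 ∣ N → jacobiSym (q : ℤ) ℓ = ε q)},
        ∃ a : ℕ, 0 < a ∧ a < ℓ ∧ z = (modularSymbol f (((3 * a : ℕ) : ℚ) / ℓ) - modularSymbol f 0) -
          (modularSymbol f ((a : ℚ) / ℓ) - modularSymbol f 0)} := by
  rw [shiftSpan_admissible_eq_closure_columns f ε hε h9 ℓ₀, shiftSpan_admissible_eq_closure_columns f ε hε h9 ℓ₁]

end ShiftColumns

end Summit.BirchSwinnertonDyer.BirchSwinnertonDyer.Theorems.ManinLocalTwoThree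

end
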